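import Literature.Barriers.QuantumAdvantage.PPolyOracles
import Literature.Computability.Complexity.OracleEmpty
import HarnessLib

/-!
# `PPolyOracleSeparation` at the empty oracle: "we wouldn't even need an oracle" (Aaronson–Chen 2017, §1)

Sibling proof file of the D-0021 barrier entry
`Literature/Barriers/QuantumAdvantage/PPolyOracles.lean`, about its TECHNIQUE CLASS
`PPolyOracleSeparation := ∃ O ∈ P/poly, BPP^O ≠ BQP^O` (language form).

**Status of the statement (not a printed theorem).** S. Aaronson, L. Chen, *Complexity-theoretic
foundations of quantum supremacy experiments*, CCC 2017 (arXiv:1612.05903, whose numbering we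
follow) [AaronsonChen2017] prove `PPolyOracleSeparation` only from one-way functions — Thm. 7.6
(p. 30): "Assuming one-way functions exist, there exists an oracle `O ∈ P/poly` such that
`BPP^O ≠ BQP^O`", vendored as `aaronsonChen2017_thm76 : OWFExist → PPolyOracleSeparation` —
and list weakening that hypothesis as Open Problem (7) (§9, p. 34): "we showed that there is an
oracle `O` in `P/poly` separating `BPP` from `BQP`, assuming that one-way functions exist. Is it
possible to weaken the assumption to, say, `NP ⊄ BPP`?". By Thm. 8.1 an unconditional proof
would prove `SampBPP ≠ SampBQP ∨ NP ⊄ BPP` (entry file, `sampP_ne_or_NP_not_subset`). So the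
bare `Prop` is an open statement (true under `OWFExist`, false under
`SampBPP = SampBQP ∧ NP ⊆ BPP`), and no `PPolyOracleSeparation_holds` is to be expected.

**What this file proves.** §1 (p. 9): to separate quantum from classical computation relative
to efficiently computable oracles "we need to assume something about the unrelativized world:
either `SampBPP ≠ SampBQP` (in which case we wouldn't even need an oracle), or else
`NP ⊄ BPP`". At the language level the parenthetical is the remark that the EMPTY oracle is
efficiently computable — `∅ ∈ SIZE(1) ⊆ P/poly` (`zero_mem_SIZE_one`, `zero_mem_PPoly`: the
one-gate constant-`0` circuit) — and powerless — `BPP^∅ = BPP` (`BPPRel_ofLanguage_zero`, from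
the discharged tree fact `PRel_empty_holds : P^∅ = P`) and `BQP^0 = BQP` (the tree fact
`BQPRel_zero`, a hypothesis) — so that an unrelativized separation `BPP ≠ BQP`, in particular
the summit's definiens `∃ L, L ∈ BQP ∧ L ∉ BPP`
(`Summits/QuantumAdvantage/QuantumAdvantage/Statement.lean`, which Literature cannot import; the
`Prop` is restated verbatim), is already a `P/poly`-oracle separation
(`pPolyOracleSeparation_of_BPP_ne_BQP`, `pPolyOracleSeparation_of_exists_mem_BQP_not_mem_BPP`).
With the entry file's reading of Thm. 8.1 this brackets the technique class
(`pPolyOracleSeparation_bracket`):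
`(∃ L ∈ BQP, L ∉ BPP) ⟹ PPolyOracleSeparation ⟹ SampBPP ≠ SampBQP ∨ NP ⊄ BPP`,
and gives Thm. 8.1 at the empty oracle (`not_collapse_of_BPP_ne_BQP`).

## Design notes

* Same models as the entry file: `PPoly`/`SIZE` (G01 `CircuitClasses.lean`, `B₂`-circuits),
  `BPPRel (Oracle.ofLanguage O) = bp (P^O)`, `BQPRel` (Q2, XOR-query gates), `BPP`, `BQP`;
  `Oracle.ofLanguage 0` is definitionally `Oracle.empty`.
* `PRel_empty` is discharged (`Literature/Computability/Complexity/OracleEmpty.lean`), whence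
  the import; `BQPRel_zero : BQPRel 0 = BQP` (`ClassBQP.lean`) is an undischarged tree fact and
  stays a hypothesis, exactly as in the sibling anchor `summit_shape_empty_iff`.

## Sources

* [AaronsonChen2017] arXiv:1612.05903 (read via `lit read arxiv:1612.05903`): §1 (p. 9, the
  "smooth tradeoff" and the parenthetical quoted above), Thm. 7.6 (p. 30), Thm. 8.1 (p. 32),
  §9 Open Problem (7) (p. 34).
* [BakerGillSolovay1975] through the tree fact `PRel_empty` (`P^∅ = P`).
-/

noncomputable section

namespace Literature.Barriers.QuantumAdvantage

open _root_.Computability Literature.Computability.Complexity Literature.Computability.Complexity.Nondeterministic Literature.Computability.Cryptography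

/-! ### The empty oracle is efficiently computable -/

/-- The empty language is decided by the one-gate constant-`0` circuit at every input length:
`∅ ∈ SIZE(1)`. [folklore] -/
theorem zero_mem_SIZE_one : (0 : Language Bool) ∈ SIZE (fun _ => 1) := by
  refine ⟨fun n => Circuit.const (Fin n) false, fun n => ⟨?_, le_rfl⟩, fun x => ?_⟩
  · intro g hg
    have hg' : g = ⟨0, fun _ => false, Fin.elim0⟩ := List.mem_singleton.1 hg
    subst hg'
    show (0 : ℕ) ≤ 2
    exact Nat.zero_le 2
  · exact ((Set.notMem_iff_boolIndicator (0 : Language Bool) x).1 (Language.notMem_zero x)).symm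

/-- Hence the empty oracle language is efficiently computable: `∅ ∈ P/poly`. [folklore] -/
theorem zero_mem_PPoly : (0 : Language Bool) ∈ PPoly :=
  SIZE_subset_PPoly (Polynomial.C 1) (fun n => by simp) zero_mem_SIZE_one

/-! ### The empty oracle is powerless -/

/-- `BPP^∅ = BPP` at the oracle `Oracle.ofLanguage 0` (definitionally `Oracle.empty`), from the
discharged tree fact `PRel_empty_holds : P^∅ = P` (`BPPRel O = bp (P^O)`, `BPP = bp P`).
[cite: BakerGillSolovay1975, §1 (P^∅ = P)] -/
theorem BPPRel_ofLanguage_zero : BPPRel (Oracle.ofLanguage 0) = BPP :=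
  BPPRel_empty PRel_empty_holds

/-! ### "In which case we wouldn't even need an oracle" -/

/-- **An unrelativized separation is a `P/poly`-oracle separation**: if `BPP ≠ BQP` then the
empty oracle (`∅ ∈ P/poly`, `BPP^∅ = BPP`, `BQP^0 = BQP`) witnesses `PPolyOracleSeparation`.
[cite: AaronsonChen2017, §1 (p. 9)] -/
theorem pPolyOracleSeparation_of_BPP_ne_BQP (hZ : BQPRel_zero) (h : BPP ≠ BQP) :
    PPolyOracleSeparation := by
  refine ⟨0, zero_mem_PPoly, ?_⟩
  rw [BPPRel_ofLanguage_zero, show BQPRel 0 = BQP from hZ]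
  exact h

/-- The summit's definiens `∃ L, L ∈ BQP ∧ L ∉ BPP` (restated verbatim) already yields the
technique class — `QuantumAdvantage ⟹ PPolyOracleSeparation`: the technique class is no
stronger than the summit statement it interpolates towards. [cite: AaronsonChen2017, §1 (p. 9)] -/
theorem pPolyOracleSeparation_of_exists_mem_BQP_not_mem_BPP (hZ : BQPRel_zero)
    (h : ∃ L : Language Bool, L ∈ BQP ∧ L ∉ BPP) : PPolyOracleSeparation := by
  refine pPolyOracleSeparation_of_BPP_ne_BQP hZ fun heq => ?_
  obtain ⟨L, hL, hL'⟩ := h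
  exact hL' (heq ▸ hL)

/-- **Thm. 8.1 at the empty oracle**: under `SampBPP = SampBQP ∧ NP ⊆ BPP` the unrelativized
classes cannot be separated either, i.e. `BPP ≠ BQP` refutes the conjunction (through the entry
file's `not_collapse_of_pPolyOracleSeparation`). [cite: AaronsonChen2017, Thm. 8.1 and §1 (p. 9)] -/
theorem not_collapse_of_BPP_ne_BQP (h81 : aaronsonChen2017_thm81) (hZ : BQPRel_zero)
    (h : BPP ≠ BQP) : ¬ (SampP = SampBQP ∧ NP ⊆ BPP) :=
  not_collapse_of_pPolyOracleSeparation h81 (pPolyOracleSeparation_of_BPP_ne_BQP hZ h)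

/-- **The bracket of the technique class**: the summit shape implies it, and (Thm. 8.1) it
implies the disjunction of unrelativized separations —
`(∃ L ∈ BQP, L ∉ BPP) → PPolyOracleSeparation` and
`PPolyOracleSeparation → SampBPP ≠ SampBQP ∨ NP ⊄ BPP`.
[cite: AaronsonChen2017, §1 (p. 9) and Thm. 8.1] -/
theorem pPolyOracleSeparation_bracket (h81 : aaronsonChen2017_thm81) (hZ : BQPRel_zero) :
    ((∃ L : Language Bool, L ∈ BQP ∧ L ∉ BPP) → PPolyOracleSeparation) ∧
      (PPolyOracleSeparation → SampP ≠ SampBQP ∨ ¬ NP ⊆ BPP) :=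
  ⟨pPolyOracleSeparation_of_exists_mem_BQP_not_mem_BPP hZ, sampP_ne_or_NP_not_subset h81⟩

end Literature.Barriers.QuantumAdvantage

end
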